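import Summits.ResolutionOfSingularities.ResolutionOfSingularities.Theorems.MarkedTransferCampaignW36SymbolicFGDefs
import Literature.AlgebraicGeometry.Hironaka2017.Lib.DiffPowerZariskiNagata
import Literature.AlgebraicGeometry.Hironaka2017.Lib.TransversalSaturation
import Literature.AlgebraicGeometry.Hironaka2017.Lib.SpecOrders
import Literature.AlgebraicGeometry.Resolution.Hironaka2005FlatSmoothChart
import Mathlib.Algebra.MvPolynomial.Equiv
import HarnessLib

/-!
# [L1 W3.6 lineage · R12/12a trigger (u), piece S2] The SYMBOLIC-FG class predicate on a CONE CUT `V(𝔭₀) × {0} ⊂ 𝔸ⁿ⁺¹` is the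
# finite generation of the classical symbolic Rees algebra `⊕_d 𝔭₀^{(d)}` of the prime `𝔭₀ ⊂ K[x₁,…,xₙ]`

Cell `res-hironaka`, rung L, slot W3.6 lineage (seat res-L1-s36-pv-2 g2); GAP-LEDGER R12/12a, res-adj-3's trigger (u) «a typed ambient
datum with `¬ SymbolicFGClass` BY NAME at a member» (2026-08-27T10:40:55Z / 11:32:23Z: 12a ∣ SymbolicFGClass FOLLOWS, complement
inhabitation OPEN). HOST item stmt-ResolutionOfSingularities-16155 via `--supports`. HONEST FRAMING (D-0012/D-0089): kernel theorems about
OUR class predicate `CampaignW36.SymbolicFGClass` (res-L1-s36-pv-1, `MarkedTransferCampaignW36SymbolicFGDefs`) over res-type-010's carriers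
(`S06BaseHike.diffPower`, `DiffPowerStalk.satPow`, `SpecOrders.shf/unshf`); nothing printed in [Hironaka2017] is asserted and the manuscript
stays «under review». AI-produced kernel proofs; weaker than expert review. No hypothesis of the manuscript is consumed.

**What is proved** (res-type-009's obstruction device, HOME/ledger/evidence/R12/…SannaiTanaka.md §3/§6/§7, ring side):
* `satPow_map_ringEquiv`, `familySubalgebra_fg_iff_of_ringEquiv` — transport of symbolic powers / of «`⊕ Q_d T^d` is f.g.» along ring
  isomorphisms;
* `fg_symbolicAlgebra_top_iff_of_isPrime` — on `Spec R` (`R` Noetherian, `Spec R` regular) with `C = V(P)`, `P` prime: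
  **`(⊕_d 𝓘_C^{⟨d⟩}(Spec R) T^d).FG ⟺ (⊕_d P^{(d)} T^d).FG`** (Zariski–Nagata bridge `Lib/DiffPowerZariskiNagata` read through
  `SpecOrders.unshf`);
* `isPrime_coneIdeal`, `fg_satPow_cone_iff` — for `R = K[x₀,…,xₙ]`, `P = 𝔭₀·R + (x₀)` (`𝔭₀ ⊂ K[x₁,…,xₙ]` prime, embedded by
  `rename Fin.succ`): `P` is prime and **`(⊕ P^{(d)}).FG ⟺ (⊕ 𝔭₀^{(d)}).FG`** (`MvPolynomial.finSuccEquiv` + `Lib/TransversalSaturation`);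
* `fg_of_symbolicFGClass_cone` / **`not_symbolicFGClass_cone`** — for ANY exponent `F` on `𝔸ⁿ⁺¹ = Spec R` and ANY `Σ ⊆ 𝔸ⁿ⁺¹`
  with `closure Σ = V(P)`: `SymbolicFGClass F Σ ⟹ (⊕ 𝔭₀^{(d)}).FG`; contrapositively a NON-finitely-generated symbolic Rees algebra
  `⊕ 𝔭₀^{(d)}` (Sannai–Tanaka 2019 Thm 3.7; such primes exist over every field in 12 variables — CITED, not used here) puts every
  exponent whose `Σ̄_max` is the cone cut `V(𝔭₀) × {0}` OFF `SymbolicFGClass`. What this file does NOT provide: an exponent `Ê` with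
  `Σ̄_max(Ê) = V(𝔭₀) × {0}` (res-type-009's (K2), the `Inv`-constancy joint) — the (u) member itself stays OPEN.
-/

noncomputable section

set_option linter.dupNamespace false -- mandated namespace of this single-conjunct summit

open _root_.AlgebraicGeometry _root_.TopologicalSpace _root_.CategoryTheory

namespace Summit.ResolutionOfSingularities.ResolutionOfSingularities.Theorems

open Literature.AlgebraicGeometry.Resolution
open Literature.AlgebraicGeometry.Hironaka2017
open Literature.AlgebraicGeometry.Hironaka2017.S02Preliminaries
open Literature.AlgebraicGeometry.Hironaka2017.S04CharAlgebra
open Literature.AlgebraicGeometry.Hironaka2017.S06BaseHike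
open Literature.AlgebraicGeometry.Hironaka2017.DiffPowerStalk
open Literature.AlgebraicGeometry.Hironaka2017.TransversalSaturation
open Literature.AlgebraicGeometry.Hironaka2017.SpecOrders
open Scheme.IdealSheafData

universe u

namespace CampaignW36

/-! ## Transport along ring isomorphisms -/

section Transport

variable {A B : Type u} [CommRing A] [CommRing B]

/-- Symbolic powers are transported by ring isomorphisms: `e(𝔮^{(b)}) = (e 𝔮)^{(b)}`. [folklore] -/
theorem satPow_map_ringEquiv (e : A ≃+* B) (q : Ideal A) [hq : q.IsPrime] (q' : Ideal B) [hq' : q'.IsPrime]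
    (hqq' : q' = q.map (e : A →+* B)) (b : ℕ) : (satPow q b).map (e : A →+* B) = satPow q' b := by
  have hsurj : Function.Surjective (e : A →+* B) := e.surjective
  ext y
  rw [Ideal.mem_map_iff_of_surjective _ hsurj, mem_satPow_iff]
  constructor
  · rintro ⟨x, hx, rfl⟩
    obtain ⟨s, hs, hsx⟩ := mem_satPow_iff.mp hx
    refine ⟨e s, fun h => hs ?_, ?_⟩
    · rw [hqq'] at h
      obtain ⟨s', hs', hss'⟩ := (Ideal.mem_map_iff_of_surjective _ hsurj).mp h
      rwa [← e.injective hss']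
    · rw [hqq', ← Ideal.map_pow]
      exact (Ideal.mem_map_iff_of_surjective _ hsurj).mpr ⟨s * x, hsx, by rw [map_mul]; rfl⟩
  · rintro ⟨t, ht, hty⟩
    refine ⟨e.symm y, ?_, e.apply_symm_apply y⟩
    refine ⟨e.symm t, fun h => ht ?_, ?_⟩
    · rw [hqq']
      exact (Ideal.mem_map_iff_of_surjective _ hsurj).mpr ⟨e.symm t, h, by simp⟩
    · rw [hqq', ← Ideal.map_pow] at hty
      obtain ⟨z, hz, hzt⟩ := (Ideal.mem_map_iff_of_surjective _ hsurj).mp hty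
      have : e.symm t * e.symm y = z := by
        apply e.injective
        rw [map_mul, e.apply_symm_apply, e.apply_symm_apply]
        exact hzt.symm
      rw [this]
      exact hz

/-- Finite generation of `⊕_d Q_d T^d` is invariant under ring isomorphisms (`Q_0 = A`, `Q_a Q_c ⊆ Q_{a+c}`). [folklore] -/
theorem familySubalgebra_fg_iff_of_ringEquiv (e : A ≃+* B) (Q : ℕ → Ideal A) (h0 : Q 0 = ⊤)
    (hmul : ∀ a c, Q a * Q c ≤ Q (a + c)) :
    (familySubalgebra A Q).FG ↔ (familySubalgebra B fun d => (Q d).map (e : A →+* B)).FG := by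
  constructor
  · exact familySubalgebra_fg_map (e : A →+* B) Q h0 hmul
  · intro h
    have h' := familySubalgebra_fg_map (e.symm : B →+* A) (fun d => (Q d).map (e : A →+* B))
      (by simp only [h0, Ideal.map_top]) (fun a c => by rw [← Ideal.map_mul]; exact Ideal.map_mono (hmul a c)) h
    have heq : (fun d => ((Q d).map (e : A →+* B)).map (e.symm : B →+* A)) = Q := by
      funext d
      rw [Ideal.map_map, show ((e.symm : B →+* A)).comp (e : A →+* B) = RingHom.id A from
        RingHom.ext fun a => e.symm_apply_apply a, Ideal.map_id]
    rwa [heq] at h'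

end Transport

/-! ## `Spec R`, prime case: the differential-power algebra of `V(P)` on the top open is `⊕ P^{(d)}` -/

section SpecPrime

variable (R : Type u) [CommRing R] [IsNoetherianRing R]

/-- On `Spec R` with `C = V(P)`, `P` prime, `Spec R` regular: the ideal of `R` underlying `𝓘_C^{⟨d⟩}` is `P^{(d)}` (Zariski–Nagata,
`Lib/DiffPowerZariskiNagata`, read through `SpecOrders.unshf`). [folklore] -/
theorem unshf_diffPower_eq_satPow (hR : Scheme.IsRegular (Zs R)) (P : Ideal R) [hP : P.IsPrime] (C : Closeds (Zs R))
    (hC : (C : Set (Zs R)) = {x | P ≤ x.asIdeal}) (d : ℕ) : unshf R (diffPower C d) = satPow P d := by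
  -- `𝓘_C(⊤) = P·Γ`
  have hCs : C = (shf R P).support := by
    apply Closeds.ext
    rw [hC]
    ext x
    rw [Set.mem_setOf_eq, SetLike.mem_coe, mem_support_shf_iff]
  have hPΓ : (P.map (toΓ R)).IsPrime := by
    have : (toΓ R) = ((Scheme.ΓSpecIso (.of R)).symm.commRingCatIsoToRingEquiv : R →+* Γ(Zs R, ⊤)) := rfl
    rw [this]
    exact Ideal.map_isPrime_of_equiv _
  have hI : (vanishingIdeal C).ideal ⟨⊤, isAffineOpen_top (Zs R)⟩ = P.map (toΓ R) := by
    rw [hCs, vanishingIdeal_support, radical_ideal, shf_ideal_top]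
    exact hPΓ.radical
  let 𝔭Γ : PrimeSpectrum Γ(Zs R, ⊤) := ⟨P.map (toΓ R), hPΓ⟩
  ext f
  rw [mem_unshf_iff, mem_satPow_iff]
  constructor
  · intro hf
    have h1 := mem_satPow_of_mem_ideal_diffPower C d ⟨⊤, isAffineOpen_top (Zs R)⟩ 𝔭Γ hI.le hf
    obtain ⟨σ, hσ, hσf⟩ := mem_satPow_iff.mp h1
    refine ⟨ofΓ R σ, fun h => hσ ?_, ?_⟩
    · have := Ideal.mem_map_of_mem (toΓ R) h
      rwa [toΓ_ofΓ] at this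
    · have h2 : ofΓ R (σ * toΓ R f) ∈ ((P ^ d).map (toΓ R)).map (ofΓ R) := by
        rw [Ideal.map_pow]
        exact Ideal.mem_map_of_mem _ hσf
      rw [Ideal.map_map, show (ofΓ R).comp (toΓ R) = RingHom.id R from RingHom.ext fun r => ofΓ_toΓ R r,
        Ideal.map_id, map_mul, ofΓ_toΓ] at h2
      exact h2
  · rintro ⟨s, hs, hsf⟩
    refine mem_ideal_diffPower_of_forall_minimalPrimes hR C d ⟨⊤, isAffineOpen_top (Zs R)⟩ fun 𝔭 h𝔭 => ?_
    rw [hI, Ideal.minimalPrimes_eq_subsingleton_self, Set.mem_singleton_iff] at h𝔭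
    subst h𝔭
    refine ⟨toΓ R s, fun h => hs ?_, ?_⟩
    · have := Ideal.mem_map_of_mem (ofΓ R) h
      rwa [Ideal.map_map, show (ofΓ R).comp (toΓ R) = RingHom.id R from RingHom.ext fun r => ofΓ_toΓ R r,
        Ideal.map_id, ofΓ_toΓ] at this
    · rw [← map_mul, ← Ideal.map_pow]
      exact Ideal.mem_map_of_mem _ hsf

/-- The top sections of `𝓘_C^{⟨d⟩}` on `Spec R` (`C = V(P)`, `P` prime, `Spec R` regular) are `P^{(d)}·Γ`. [folklore] -/
theorem ideal_top_diffPower_eq_map_satPow (hR : Scheme.IsRegular (Zs R)) (P : Ideal R) [P.IsPrime] (C : Closeds (Zs R))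
    (hC : (C : Set (Zs R)) = {x | P ≤ x.asIdeal}) (d : ℕ) :
    (diffPower C d).ideal ⟨⊤, isAffineOpen_top (Zs R)⟩ = (satPow P d).map (toΓ R) := by
  rw [← unshf_diffPower_eq_satPow R hR P C hC d, ← shf_ideal_top, shf_unshf]

/-- **`(⊕_d 𝓘_{V(P)}^{⟨d⟩}(Spec R) T^d).FG ⟺ (⊕_d P^{(d)} T^d).FG`** for a prime `P` of a Noetherian ring `R` with `Spec R` regular:
the symbolic-FG condition at the top affine open is the finite generation of the classical symbolic Rees algebra of `P`. [folklore] -/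
theorem fg_symbolicAlgebra_top_iff_of_isPrime (hR : Scheme.IsRegular (Zs R)) (P : Ideal R) [P.IsPrime] (C : Closeds (Zs R))
    (hC : (C : Set (Zs R)) = {x | P ≤ x.asIdeal}) :
    (familySubalgebra Γ(Zs R, ⊤) fun d => (diffPower C d).ideal ⟨⊤, isAffineOpen_top (Zs R)⟩).FG ↔
      (familySubalgebra R fun d => satPow P d).FG := by
  have heq : (fun d => (diffPower C d).ideal ⟨⊤, isAffineOpen_top (Zs R)⟩) =
      fun d => (satPow P d).map ((Scheme.ΓSpecIso (.of R)).symm.commRingCatIsoToRingEquiv : R →+* Γ(Zs R, ⊤)) :=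
    funext fun d => ideal_top_diffPower_eq_map_satPow R hR P C hC d
  rw [heq]
  exact (familySubalgebra_fg_iff_of_ringEquiv _ (fun d => satPow P d) (satPow_zero P) (satPow_mul_le P)).symm

end SpecPrime

/-! ## The cone cut `V(𝔭₀) × {0} ⊂ 𝔸ⁿ⁺¹ = Spec K[x₀, x₁, …, xₙ]` -/

section Cone

variable (K : Type u) [Field K] (n : ℕ) (𝔭₀ : Ideal (MvPolynomial (Fin n) K)) [h𝔭₀ : 𝔭₀.IsPrime]
  (P : Ideal (MvPolynomial (Fin (n + 1)) K))

omit h𝔭₀ in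
/-- `K[x₀,…,xₙ] ≅ K[x₁,…,xₙ][X]` (`x₀ ↦ X`) sends `𝔭₀·K[x] + (x₀)` to the transversal prime `𝔭₀·A[X] + (X)`. [folklore] -/
theorem map_finSuccEquiv_coneIdeal
    (hP : P = 𝔭₀.map (MvPolynomial.rename Fin.succ : MvPolynomial (Fin n) K →ₐ[K] MvPolynomial (Fin (n + 1)) K).toRingHom ⊔
      Ideal.span {MvPolynomial.X 0}) :
    P.map ((MvPolynomial.finSuccEquiv K n).toRingEquiv : MvPolynomial (Fin (n + 1)) K →+* Polynomial (MvPolynomial (Fin n) K)) =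
      𝔭₀.map (Polynomial.C : MvPolynomial (Fin n) K →+* Polynomial (MvPolynomial (Fin n) K)) ⊔ Ideal.span {Polynomial.X} := by
  have hcomp : ((MvPolynomial.finSuccEquiv K n).toRingEquiv : MvPolynomial (Fin (n + 1)) K →+* _).comp
      (MvPolynomial.rename Fin.succ : MvPolynomial (Fin n) K →ₐ[K] MvPolynomial (Fin (n + 1)) K).toRingHom = Polynomial.C := by
    refine MvPolynomial.ringHom_ext (fun a => ?_) (fun i => ?_)
    · rw [RingHom.comp_apply, AlgHom.toRingHom_eq_coe, AlgHom.coe_toRingHom, MvPolynomial.rename_C]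
      show MvPolynomial.finSuccEquiv K n (MvPolynomial.C a) = _
      rw [MvPolynomial.finSuccEquiv_apply, MvPolynomial.eval₂Hom_C, RingHom.comp_apply]
    · rw [RingHom.comp_apply, AlgHom.toRingHom_eq_coe, AlgHom.coe_toRingHom, MvPolynomial.rename_X]
      show MvPolynomial.finSuccEquiv K n (MvPolynomial.X (Fin.succ i)) = _
      rw [MvPolynomial.finSuccEquiv_X_succ]
  have hX0 : ((MvPolynomial.finSuccEquiv K n).toRingEquiv : MvPolynomial (Fin (n + 1)) K →+* Polynomial (MvPolynomial (Fin n) K))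
      (MvPolynomial.X 0) = Polynomial.X := MvPolynomial.finSuccEquiv_X_zero
  rw [hP, Ideal.map_sup, Ideal.map_map, hcomp, Ideal.map_span, Set.image_singleton, hX0]

/-- `𝔭₀·K[x₀,…,xₙ] + (x₀)` is prime. [folklore] -/
theorem isPrime_coneIdeal
    (hP : P = 𝔭₀.map (MvPolynomial.rename Fin.succ : MvPolynomial (Fin n) K →ₐ[K] MvPolynomial (Fin (n + 1)) K).toRingHom ⊔
      Ideal.span {MvPolynomial.X 0}) : P.IsPrime := by
  let e : MvPolynomial (Fin (n + 1)) K ≃+* Polynomial (MvPolynomial (Fin n) K) := (MvPolynomial.finSuccEquiv K n).toRingEquiv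
  have h1 : (P.map (e : MvPolynomial (Fin (n + 1)) K →+* Polynomial (MvPolynomial (Fin n) K))).IsPrime := by
    rw [map_finSuccEquiv_coneIdeal K n 𝔭₀ P hP]
    exact isPrime_map_C_sup_span_X 𝔭₀
  have h2 : P = (P.map (e : MvPolynomial (Fin (n + 1)) K →+* Polynomial (MvPolynomial (Fin n) K))).comap
      (e : MvPolynomial (Fin (n + 1)) K →+* Polynomial (MvPolynomial (Fin n) K)) :=
    (Ideal.comap_map_of_bijective _ e.bijective).symm
  rw [h2]
  exact Ideal.comap_isPrime _ _

/-- **`(⊕_d P^{(d)}).FG ⟺ (⊕_d 𝔭₀^{(d)}).FG`** for the cone ideal `P = 𝔭₀·K[x₀,…,xₙ] + (x₀)`: adjoining the transversal variable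
`x₀` does not change finite generation of the symbolic Rees algebra (`Lib/TransversalSaturation` through `finSuccEquiv`). [folklore] -/
theorem fg_satPow_cone_iff [hP' : P.IsPrime]
    (hP : P = 𝔭₀.map (MvPolynomial.rename Fin.succ : MvPolynomial (Fin n) K →ₐ[K] MvPolynomial (Fin (n + 1)) K).toRingHom ⊔
      Ideal.span {MvPolynomial.X 0}) :
    (familySubalgebra (MvPolynomial (Fin (n + 1)) K) fun d => satPow P d).FG ↔
      (familySubalgebra (MvPolynomial (Fin n) K) fun d => satPow 𝔭₀ d).FG := by
  let e : MvPolynomial (Fin (n + 1)) K ≃+* Polynomial (MvPolynomial (Fin n) K) := (MvPolynomial.finSuccEquiv K n).toRingEquiv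
  have hPe : P.map (e : MvPolynomial (Fin (n + 1)) K →+* Polynomial (MvPolynomial (Fin n) K)) =
      𝔭₀.map (Polynomial.C : MvPolynomial (Fin n) K →+* Polynomial (MvPolynomial (Fin n) K)) ⊔ Ideal.span {Polynomial.X} :=
    map_finSuccEquiv_coneIdeal K n 𝔭₀ P hP
  haveI hPi : (𝔭₀.map (Polynomial.C : MvPolynomial (Fin n) K →+* Polynomial (MvPolynomial (Fin n) K)) ⊔
      Ideal.span {Polynomial.X}).IsPrime := isPrime_map_C_sup_span_X 𝔭₀
  have h1 := familySubalgebra_fg_iff_of_ringEquiv e (fun d => satPow P d) (satPow_zero P) (satPow_mul_le P)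
  refine h1.trans ?_
  have heq : (fun d => (satPow P d).map (e : MvPolynomial (Fin (n + 1)) K →+* Polynomial (MvPolynomial (Fin n) K))) =
      fun d => satPow (𝔭₀.map (Polynomial.C : MvPolynomial (Fin n) K →+* Polynomial (MvPolynomial (Fin n) K)) ⊔
        Ideal.span {Polynomial.X}) d :=
    funext fun d => satPow_map_ringEquiv e P _ hPe.symm d
  rw [heq]
  exact familySubalgebra_satPow_fg_iff 𝔭₀ _ rfl

/-- `𝔸ⁿ⁺¹ = Spec K[x₀,…,xₙ]` is a regular scheme. [folklore] -/
theorem isRegular_affineSpace_fin : Scheme.IsRegular (Zs (MvPolynomial (Fin (n + 1)) K)) := by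
  haveI : Algebra.Smooth K K := {}
  exact Hironaka2005.isRegular_Spec_mvPolynomial K K (n + 1)

/-- **The SYMBOLIC-FG class predicate at the cone cut.** For ANY exponent `F` on `𝔸ⁿ⁺¹` and ANY `Σ ⊆ 𝔸ⁿ⁺¹` whose closure is the
cone cut `V(P)`, `P = 𝔭₀·K[x] + (x₀)`: `SymbolicFGClass F Σ` forces `⊕_d 𝔭₀^{(d)} T^d` to be a finitely generated `K[x₁,…,xₙ]`-algebra
(read at the top affine open; `fg_symbolicAlgebra_top_iff_of_isPrime` and `fg_satPow_cone_iff`). (The converse — a f.g. `⊕ 𝔭₀^{(d)}`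
puts the cone cut IN the class — follows with res-L1-s36-pv-1's `symbolicAlgebra_fg_iff_top`; to be appended.) [folklore] -/
theorem fg_of_symbolicFGClass_cone
    (hP : P = 𝔭₀.map (MvPolynomial.rename Fin.succ : MvPolynomial (Fin n) K →ₐ[K] MvPolynomial (Fin (n + 1)) K).toRingHom ⊔
      Ideal.span {MvPolynomial.X 0})
    (F : IdealExponent (Zs (MvPolynomial (Fin (n + 1)) K))) (Sig : Set (Zs (MvPolynomial (Fin (n + 1)) K)))
    (hSig : closure Sig = {x | P ≤ x.asIdeal}) (h : SymbolicFGClass F Sig) :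
    (familySubalgebra (MvPolynomial (Fin n) K) fun d => satPow 𝔭₀ d).FG := by
  haveI := isPrime_coneIdeal K n 𝔭₀ P hP
  have htop := h ⟨⊤, isAffineOpen_top _⟩
  rw [fg_symbolicAlgebra_top_iff_of_isPrime (MvPolynomial (Fin (n + 1)) K) (isRegular_affineSpace_fin K n) P (Closeds.closure Sig)
    (by rw [Closeds.coe_closure, hSig])] at htop
  exact (fg_satPow_cone_iff K n 𝔭₀ P hP).mp htop

/-- **NON-finitely-generated `⊕ 𝔭₀^{(d)}` ⟹ the cone cut is OFF `SymbolicFGClass`** — for every exponent `F` and every `Σ` with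
`closure Σ = V(𝔭₀·K[x] + (x₀))`. With a cited non-Noetherian symbolic Rees algebra (Sannai–Tanaka 2019, Thm 3.7: over any field, a prime
of `k[x₁,…,x₁₂]`; Kurano et al. 2025) this is the algebra side of res-adj-3's trigger (u); the missing geometric side is an exponent `Ê`
with `Σ̄_max(Ê)` equal to this cut ((K2), not claimed). [folklore] -/
theorem not_symbolicFGClass_cone
    (hP : P = 𝔭₀.map (MvPolynomial.rename Fin.succ : MvPolynomial (Fin n) K →ₐ[K] MvPolynomial (Fin (n + 1)) K).toRingHom ⊔
      Ideal.span {MvPolynomial.X 0})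
    (hfg : ¬ (familySubalgebra (MvPolynomial (Fin n) K) fun d => satPow 𝔭₀ d).FG)
    (F : IdealExponent (Zs (MvPolynomial (Fin (n + 1)) K))) (Sig : Set (Zs (MvPolynomial (Fin (n + 1)) K)))
    (hSig : closure Sig = {x | P ≤ x.asIdeal}) : ¬ SymbolicFGClass F Sig :=
  fun h => hfg (fg_of_symbolicFGClass_cone K n 𝔭₀ P hP F Sig hSig h)

end Cone

/-! ## Appendix (rev 2): the EXACT form — `SymbolicFGClass` at the cone cut ⟺ `⊕ 𝔭₀^{(d)}` finitely generated -/

section ConeIff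

variable (K : Type u) [Field K] (n : ℕ) (𝔭₀ : Ideal (MvPolynomial (Fin n) K)) [h𝔭₀ : 𝔭₀.IsPrime]
  (P : Ideal (MvPolynomial (Fin (n + 1)) K))

/-- **The SYMBOLIC-FG class predicate at the cone cut, EXACTLY** (rev 2). For ANY exponent `F` on `𝔸ⁿ⁺¹` and ANY `Σ ⊆ 𝔸ⁿ⁺¹` whose
closure is the cone cut `V(P)`, `P = 𝔭₀·K[x] + (x₀)`: `SymbolicFGClass F Σ ⟺ ⊕_d 𝔭₀^{(d)} T^d` is a finitely generated
`K[x₁,…,xₙ]`-algebra — with res-L1-s36-pv-1's `symbolicAlgebra_fg_iff_top` (p529103: on an affine ambient the top algebra decides),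
`fg_symbolicAlgebra_top_iff_of_isPrime` and `fg_satPow_cone_iff`. [folklore] -/
theorem symbolicFGClass_cone_iff
    (hP : P = 𝔭₀.map (MvPolynomial.rename Fin.succ : MvPolynomial (Fin n) K →ₐ[K] MvPolynomial (Fin (n + 1)) K).toRingHom ⊔
      Ideal.span {MvPolynomial.X 0})
    (F : IdealExponent (Zs (MvPolynomial (Fin (n + 1)) K))) (Sig : Set (Zs (MvPolynomial (Fin (n + 1)) K)))
    (hSig : closure Sig = {x | P ≤ x.asIdeal}) :
    SymbolicFGClass F Sig ↔ (familySubalgebra (MvPolynomial (Fin n) K) fun d => satPow 𝔭₀ d).FG := by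
  haveI := isPrime_coneIdeal K n 𝔭₀ P hP
  rw [symbolicFGClass_iff, symbolicAlgebra_fg_iff_top (Closeds.closure Sig),
    fg_symbolicAlgebra_top_iff_of_isPrime (MvPolynomial (Fin (n + 1)) K) (isRegular_affineSpace_fin K n) P (Closeds.closure Sig)
      (by rw [Closeds.coe_closure, hSig])]
  exact fg_satPow_cone_iff K n 𝔭₀ P hP

/-- Conversely a finitely generated `⊕_d 𝔭₀^{(d)}` puts every `(F, Σ)` with `closure Σ` the cone cut IN `SymbolicFGClass` (so by the
SYMBOLIC-FG door such data DO have core focusings). [folklore] -/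
theorem symbolicFGClass_cone_of_fg
    (hP : P = 𝔭₀.map (MvPolynomial.rename Fin.succ : MvPolynomial (Fin n) K →ₐ[K] MvPolynomial (Fin (n + 1)) K).toRingHom ⊔
      Ideal.span {MvPolynomial.X 0})
    (hfg : (familySubalgebra (MvPolynomial (Fin n) K) fun d => satPow 𝔭₀ d).FG)
    (F : IdealExponent (Zs (MvPolynomial (Fin (n + 1)) K))) (Sig : Set (Zs (MvPolynomial (Fin (n + 1)) K)))
    (hSig : closure Sig = {x | P ≤ x.asIdeal}) : SymbolicFGClass F Sig :=
  (symbolicFGClass_cone_iff K n 𝔭₀ P hP F Sig hSig).mpr hfg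

end ConeIff

end CampaignW36

end Summit.ResolutionOfSingularities.ResolutionOfSingularities.Theorems

end
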